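import Literature.MathematicalPhysics.QuantumManyBody.PeriodicBoseGasImpurityTranslation
import Literature.MathematicalPhysics.QuantumManyBody.PeriodicFeynmanKacCell
import Literature.MathematicalPhysics.QuantumManyBody.LiebYngvasonLowerBound
import Mathlib.MeasureTheory.Function.Floor
import HarnessLib

/-!
# No binding from classical stability, III: from the grid of Neumann cells to the torus

Topic `Literature/MathematicalPhysics/QuantumManyBody`; the torus step of [Lee2009, Thm. 7]
("Proof of Theorem 7", pp. 6–7). Lee averages Neumann cell decompositions over a continuously
shifted grid (after Conlon–Lieb–Yau) and compares `V h_ℓ` with `V`. Here the sliding average is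
replaced by a **finite** average over the `8` half-mesh shifts `s_ε = (ℓ/2)ε`, `ε ∈ {0,1}³`, of
the grid of mesh `ℓ` on the torus of side `L = Mℓ`:

* `exists_halfShift_reduce` (1D) / `exists_shift_sameCell` (3D) — **covering lemma**: two
  points of the circle `ℝ/Lℤ` at circular distance `≤ ℓ/4` lie, after a shift by `0` or `ℓ/2`
  and reduction to `[0, L)`, in a common arc `[qℓ, (q+1)ℓ)`, and their reduced representatives
  differ by the nearest-image difference;
* `periodizedPotential_eq_zero_or_exists` — for `W` of range `R₀ < L/2`, the periodisation
  `W^per(z) = ∑_n W(|z - Ln|)` is either `0` or its single nearest-image term;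
* `periodicInteraction_le_sum_sameCell` — hence, pointwise, for `4R₀ ≤ ℓ`:
  `∑_{i<j} W^per(xᵢ-xⱼ) ≤ ∑_ε ∑_{i<j, same grid cube} W(|yᵢ-yⱼ|)`, `y = red_L(x + s_ε)`;
* `torus_domination_of_grid` — **the torus step**: if for every periodic trial state `Φ` the
  same-cell `W`-pair form on the big cube `Λ_L^N` is dominated by the Neumann energy with `v`
  (the conclusion of the cell method of `LeeNoBindingCellFibre.lean`, taken here as a
  hypothesis), then for every periodic trial state `Ψ`,
  `c ∫_{[0,L)^{3N}} (∑_{i<j} W^per(xᵢ-xⱼ)) |Ψ|² ≤ 8 · periodicEnergy v Ψ`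
  (translate `Ψ` by each `s_ε` — `PeriodicTrialState.exists_translate`,
  `periodicEnergy_translate` — and use Neumann `≤` periodic,
  `PeriodicTrialState.neumannEnergy_toNeumann_le`).

## References

* [Lee2009] J. O. Lee, *Ground state energy of dilute Bose gas in small negative potential
  case*, J. Stat. Phys. 134 (2009) 1–18, arXiv:0803.0533: proof of Thm. 7, Lemma 11 (pp. 6–7).
* [LSSY2005] E. H. Lieb, R. Seiringer, J. P. Solovej, J. Yngvason, *The Mathematics of the Bose
  Gas and its Condensation* (2005), Ch. 2 (Neumann conditions give the lowest energy).
-/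

noncomputable section

open MeasureTheory Filter Metric WithLp
open scoped ENNReal NNReal

namespace Literature.MathematicalPhysics.QuantumManyBody.BoseGas

/-! ### The covering lemma on the circle -/

/-- Reduction modulo `L = Mℓ` of a point of the arc `[qℓ, (q+1)ℓ)`: the period index is
`⌊a/L⌋ = ⌊q/M⌋` and the reduced point lies in the arc of index `q mod M`. [folklore] -/
theorem floor_reduce_of_mem_arc {ℓ : ℝ} (hℓ : 0 < ℓ) {M : ℕ} (hM : 0 < M) {a : ℝ} {q : ℤ}
    (ha : q * ℓ ≤ a) (ha' : a < (q + 1) * ℓ) :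
    ⌊a / (M * ℓ)⌋ = q / M ∧ ⌊(a - M * ℓ * ⌊a / (M * ℓ)⌋) / ℓ⌋ = q % M := by
  have hMr : (0 : ℝ) < M := by exact_mod_cast hM
  have hL : 0 < (M : ℝ) * ℓ := by positivity
  set p := q / (M : ℤ) with hp
  set j := q % (M : ℤ) with hj
  have hqM : (M : ℤ) * p + j = q := Int.mul_ediv_add_emod q M
  have hj0 : (0 : ℤ) ≤ j := Int.emod_nonneg q (by exact_mod_cast hM.ne')
  have hjM : j + 1 ≤ (M : ℤ) := Int.emod_lt_of_pos q (by exact_mod_cast hM)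
  have hq : (q : ℝ) = (M : ℝ) * (p : ℝ) + (j : ℝ) := by exact_mod_cast hqM.symm
  have hj0r : (0 : ℝ) ≤ j := by exact_mod_cast hj0
  have hjMr : (j : ℝ) + 1 ≤ M := by exact_mod_cast hjM
  have hqℓ : (q : ℝ) * ℓ = M * p * ℓ + j * ℓ := by rw [hq]; ring
  have hjℓ : 0 ≤ (j : ℝ) * ℓ := mul_nonneg hj0r hℓ.le
  have hjℓ' : ((j : ℝ) + 1) * ℓ ≤ M * ℓ := mul_le_mul_of_nonneg_right hjMr hℓ.le
  have hfa : ⌊a / (M * ℓ)⌋ = p := by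
    rw [Int.floor_eq_iff, le_div_iff₀ hL, div_lt_iff₀ hL]
    constructor
    · nlinarith
    · nlinarith
  refine ⟨hfa, ?_⟩
  rw [hfa, Int.floor_eq_iff, le_div_iff₀ hℓ, div_lt_iff₀ hℓ]
  constructor
  · nlinarith
  · nlinarith

/-- Two points of a common arc `[qℓ, (q+1)ℓ)`: after reduction modulo `L = Mℓ` they lie in a
common arc of `[0, L)` and their difference is unchanged. [folklore] -/
theorem reduce_pair_of_mem_arc {ℓ : ℝ} (hℓ : 0 < ℓ) {M : ℕ} (hM : 0 < M) {a b : ℝ} {q : ℤ}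
    (ha : q * ℓ ≤ a) (ha' : a < (q + 1) * ℓ) (hb : q * ℓ ≤ b) (hb' : b < (q + 1) * ℓ) :
    ⌊(a - M * ℓ * ⌊a / (M * ℓ)⌋) / ℓ⌋ = ⌊(b - M * ℓ * ⌊b / (M * ℓ)⌋) / ℓ⌋ ∧
      (a - M * ℓ * ⌊a / (M * ℓ)⌋) - (b - M * ℓ * ⌊b / (M * ℓ)⌋) = a - b := by
  obtain ⟨ha1, ha2⟩ := floor_reduce_of_mem_arc hℓ hM ha ha'
  obtain ⟨hb1, hb2⟩ := floor_reduce_of_mem_arc hℓ hM hb hb'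
  refine ⟨by rw [ha2, hb2], ?_⟩
  rw [ha1, hb1]
  ring

/-- Two points of the line at distance `≤ ℓ/4` lie in a common arc `[qℓ, (q+1)ℓ)` of the grid
of mesh `ℓ` after a common shift by `0` or by `ℓ/2`. [folklore] -/
theorem exists_halfShift_mem_arc {ℓ : ℝ} (hℓ : 0 < ℓ) {a b : ℝ} (hab : |a - b| ≤ ℓ / 4) :
    ∃ ε : Fin 2, ∃ q : ℤ,
      q * ℓ ≤ a + (ε : ℕ) * (ℓ / 2) ∧ a + (ε : ℕ) * (ℓ / 2) < (q + 1) * ℓ ∧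
        q * ℓ ≤ b + (ε : ℕ) * (ℓ / 2) ∧ b + (ε : ℕ) * (ℓ / 2) < (q + 1) * ℓ := by
  obtain ⟨hab1, hab2⟩ := abs_le.1 hab
  set q₀ := ⌊a / ℓ⌋ with hq₀
  have h1 : (q₀ : ℝ) * ℓ ≤ a := by
    have := Int.floor_le (a / ℓ)
    rwa [le_div_iff₀ hℓ] at this
  have h2 : a < (q₀ + 1) * ℓ := by
    have := Int.lt_floor_add_one (a / ℓ)
    rwa [div_lt_iff₀ hℓ] at this
  by_cases hlo : a < q₀ * ℓ + ℓ / 4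
  · refine ⟨1, q₀, ?_, ?_, ?_, ?_⟩ <;> simp <;> linarith
  · by_cases hhi : q₀ * ℓ + 3 * ℓ / 4 ≤ a
    · refine ⟨1, q₀ + 1, ?_, ?_, ?_, ?_⟩ <;> push_cast <;> simp <;> linarith
    · refine ⟨0, q₀, ?_, ?_, ?_, ?_⟩ <;> simp <;> linarith

/-- **Covering lemma on the circle `ℝ/Lℤ`, `L = Mℓ`.** If `|a - b - Ln| ≤ ℓ/4` for some
integer `n` (circular distance `≤ ℓ/4`), then for a common shift by `0` or `ℓ/2` the reduced
representatives `red(t) = t - L⌊t/L⌋ ∈ [0, L)` of the shifted points lie in a common arc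
`[jℓ, (j+1)ℓ)` and differ by exactly `a - b - Ln`. [folklore] -/
theorem exists_halfShift_reduce {ℓ : ℝ} (hℓ : 0 < ℓ) {M : ℕ} (hM : 0 < M) {a b : ℝ} {n : ℤ}
    (h : |a - b - M * ℓ * n| ≤ ℓ / 4) :
    ∃ ε : Fin 2,
      ⌊(a + (ε : ℕ) * (ℓ / 2) - M * ℓ * ⌊(a + (ε : ℕ) * (ℓ / 2)) / (M * ℓ)⌋) / ℓ⌋ =
          ⌊(b + (ε : ℕ) * (ℓ / 2) - M * ℓ * ⌊(b + (ε : ℕ) * (ℓ / 2)) / (M * ℓ)⌋) / ℓ⌋ ∧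
        (a + (ε : ℕ) * (ℓ / 2) - M * ℓ * ⌊(a + (ε : ℕ) * (ℓ / 2)) / (M * ℓ)⌋) -
            (b + (ε : ℕ) * (ℓ / 2) - M * ℓ * ⌊(b + (ε : ℕ) * (ℓ / 2)) / (M * ℓ)⌋) =
          a - b - M * ℓ * n := by
  have hMr : (0 : ℝ) < M := by exact_mod_cast hM
  have hL : (M : ℝ) * ℓ ≠ 0 := by positivity
  obtain ⟨ε, q, h1, h2, h3, h4⟩ := exists_halfShift_mem_arc hℓ (a := a - M * ℓ * n) (b := b)
    (by rwa [show a - M * ℓ * n - b = a - b - M * ℓ * n by ring])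
  refine ⟨ε, ?_⟩
  have key := reduce_pair_of_mem_arc hℓ hM h1 h2 h3 h4
  have hfl : ⌊(a - M * ℓ * n + (ε : ℕ) * (ℓ / 2)) / (M * ℓ)⌋ =
      ⌊(a + (ε : ℕ) * (ℓ / 2)) / (M * ℓ)⌋ - n := by
    rw [← Int.floor_sub_intCast]
    congr 1
    field_simp
    ring
  rw [hfl] at key
  push_cast at key
  constructor
  · rw [← key.1]
    congr 2
    ring
  · linear_combination key.2

/-- **Covering lemma on the torus `(ℝ/Lℤ)³`, `L = Mℓ`.** If `x - y - Ln` has all coordinates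
of size `≤ ℓ/4`, there is a shift `s_ε = (ℓ/2)ε`, `ε ∈ {0,1}³`, after which the reduced
representatives of `x + s_ε` and `y + s_ε` lie in a common cube of the grid of mesh `ℓ` and
differ by `x - y - Ln`, coordinate by coordinate. [folklore] -/
theorem exists_shift_sameCell {ℓ : ℝ} (hℓ : 0 < ℓ) {M : ℕ} (hM : 0 < M) (x y : Space)
    (n : Fin 3 → ℤ) (h : ∀ k, |x k - y k - M * ℓ * n k| ≤ ℓ / 4) :
    ∃ ε : Fin 3 → Fin 2, ∀ k,
      ⌊(x k + (ε k : ℕ) * (ℓ / 2) - M * ℓ * ⌊(x k + (ε k : ℕ) * (ℓ / 2)) / (M * ℓ)⌋) / ℓ⌋ =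
          ⌊(y k + (ε k : ℕ) * (ℓ / 2) - M * ℓ * ⌊(y k + (ε k : ℕ) * (ℓ / 2)) / (M * ℓ)⌋) / ℓ⌋ ∧
        (x k + (ε k : ℕ) * (ℓ / 2) - M * ℓ * ⌊(x k + (ε k : ℕ) * (ℓ / 2)) / (M * ℓ)⌋) -
            (y k + (ε k : ℕ) * (ℓ / 2) - M * ℓ * ⌊(y k + (ε k : ℕ) * (ℓ / 2)) / (M * ℓ)⌋) =
          x k - y k - M * ℓ * n k := by
  choose ε hε using fun k => exists_halfShift_reduce hℓ hM (h k)
  exact ⟨ε, hε⟩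

/-! ### Nearest image for a finite-range pair weight -/

/-- For `W` of range `R₀` (`W(r) = 0` for `r > R₀`) and `2R₀ < L`, the periodisation
`W^per(z) = ∑_{n ∈ ℤ³} W(|z - Ln|)` either vanishes or equals its single term with
`|z - Ln₀| ≤ R₀` (two such lattice points would be within `2R₀ < L` of each other).
[folklore] -/
theorem periodizedPotential_eq_zero_or_exists {W : ℝ → ℝ≥0∞} {R₀ L : ℝ}
    (hWR : ∀ r, R₀ < r → W r = 0) (h2R : 2 * R₀ < L) (hL : 0 < L) (z : Space) :
    periodizedPotential W L z = 0 ∨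
      ∃ n₀ : Fin 3 → ℤ, ‖z - latticeVec L n₀‖ ≤ R₀ ∧
        periodizedPotential W L z = W ‖z - latticeVec L n₀‖ := by
  by_cases h : ∃ n₀ : Fin 3 → ℤ, ‖z - latticeVec L n₀‖ ≤ R₀
  · obtain ⟨n₀, hn₀⟩ := h
    refine Or.inr ⟨n₀, hn₀, ?_⟩
    unfold periodizedPotential
    refine tsum_eq_single n₀ fun n hn => hWR _ ?_
    obtain ⟨k, hk⟩ : ∃ k, n k ≠ n₀ k := Function.ne_iff.1 hn
    have h1 : (1 : ℝ) ≤ |((n k : ℝ) - n₀ k)| := by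
      have : (1 : ℤ) ≤ |n k - n₀ k| := Int.one_le_abs (sub_ne_zero.2 hk)
      exact_mod_cast this
    have h2 : L ≤ |L * ((n k : ℝ) - n₀ k)| := by
      rw [abs_mul, abs_of_pos hL]
      nlinarith
    have h3 : |L * ((n k : ℝ) - n₀ k)| ≤ ‖z - latticeVec L n₀‖ + ‖z - latticeVec L n‖ := by
      have hk' : L * ((n k : ℝ) - n₀ k) = ((z - latticeVec L n₀) - (z - latticeVec L n)) k := by
        simp only [PiLp.sub_apply]
        change L * ((n k : ℝ) - n₀ k) = z k - L * (n₀ k : ℝ) - (z k - L * (n k : ℝ))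
        ring
      rw [hk', ← Real.norm_eq_abs]
      exact (PiLp.norm_apply_le _ k).trans (norm_sub_le _ _)
    linarith
  · push Not at h
    left
    unfold periodizedPotential
    exact ENNReal.tsum_eq_zero.2 fun n => hWR _ (h n)

/-! ### The pointwise covering inequality -/

/-- Coordinates of the reduction modulo `(Lℤ³)^N`: `red_L(Y)_{i,k} = Y_{i,k} - L⌊Y_{i,k}/L⌋`.
[folklore] -/
theorem cellProj_apply_apply {N : ℕ} (L : ℝ) (Y : Config N) (i : Fin N) (k : Fin 3) :
    cellProj L Y i k = Y i k - L * ⌊Y i k / L⌋ := rfl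

/-- **Pointwise covering inequality.** Let `W ≥ 0` have range `R₀` with `4R₀ ≤ ℓ`, and
`L = Mℓ`, `M ≥ 1`. For every configuration `X` of `N` points,
`∑_{i<j} W^per(xᵢ - xⱼ) ≤ ∑_{ε ∈ {0,1}³} ∑_{i<j, same grid cube} W(|yᵢ - yⱼ|)`, where
`y = red_L(x + s_ε)`, `s_ε = (ℓ/2)ε`, and "same grid cube" means `⌊yᵢ/ℓ⌋ = ⌊yⱼ/ℓ⌋`
coordinatewise: each pair within the range (in torus distance) is, for a suitable shift, a
same-cube pair of reduced points at the same distance. [cite: Lee2009, proof of Thm. 7] -/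
theorem periodicInteraction_le_sum_sameCell {N M : ℕ} (hM : 0 < M) {ℓ : ℝ} (hℓ : 0 < ℓ)
    {W : ℝ → ℝ≥0∞} {R₀ : ℝ} (hWR : ∀ r, R₀ < r → W r = 0) (hRℓ : 4 * R₀ ≤ ℓ) (X : Config N) :
    periodicInteraction W (M * ℓ) X ≤
      ∑ ε : Fin 3 → Fin 2, (fun Y : Config N => ∑ i : Fin N, ∑ j : Fin N with i < j,
        if (∀ k : Fin 3, ⌊Y i k / ℓ⌋ = ⌊Y j k / ℓ⌋) then W (dist (Y i) (Y j)) else 0)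
        (cellProj (M * ℓ) (X + fun _ => toLp 2 fun k => ((ε k : ℕ) : ℝ) * (ℓ / 2))) := by
  have hMr : (1 : ℝ) ≤ M := by exact_mod_cast hM
  set L := (M : ℝ) * ℓ with hL_def
  have hL : 0 < L := by positivity
  have hℓL : ℓ ≤ L := by
    have : (1 : ℝ) * ℓ ≤ M * ℓ := mul_le_mul_of_nonneg_right hMr hℓ.le
    linarith
  have h2R : 2 * R₀ < L := by
    rcases le_or_gt R₀ 0 with hR | hR
    · linarith
    · linarith
  unfold periodicInteraction
  simp only []
  rw [Finset.sum_comm]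
  refine Finset.sum_le_sum fun i _ => ?_
  rw [Finset.sum_comm]
  refine Finset.sum_le_sum fun j _ => ?_
  -- one pair
  rcases periodizedPotential_eq_zero_or_exists hWR h2R hL (X i - X j) with h0 | ⟨n₀, hn₀, hper⟩
  · rw [h0]; exact bot_le
  have hcoord : ∀ k, |X i k - X j k - M * ℓ * n₀ k| ≤ ℓ / 4 := fun k => by
    calc |X i k - X j k - M * ℓ * n₀ k| = ‖(X i - X j - latticeVec L n₀) k‖ := by
          rw [Real.norm_eq_abs]
          rfl
      _ ≤ ‖X i - X j - latticeVec L n₀‖ := PiLp.norm_apply_le _ k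
      _ ≤ ℓ / 4 := by linarith
  obtain ⟨ε, hε⟩ := exists_shift_sameCell hℓ hM (X i) (X j) n₀ hcoord
  refine le_trans (le_of_eq ?_) (Finset.single_le_sum (f := fun ε : Fin 3 → Fin 2 =>
    (fun Y : Config N => if (∀ k : Fin 3, ⌊Y i k / ℓ⌋ = ⌊Y j k / ℓ⌋) then
      W (dist (Y i) (Y j)) else 0)
      (cellProj (M * ℓ) (X + fun _ => toLp 2 fun k => ((ε k : ℕ) : ℝ) * (ℓ / 2))))
    (fun _ _ => bot_le) (Finset.mem_univ ε))
  set P := cellProj (M * ℓ) (X + fun _ => toLp 2 fun k => ((ε k : ℕ) : ℝ) * (ℓ / 2)) with hP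
  have hPi : ∀ k, P i k = X i k + (ε k : ℕ) * (ℓ / 2) -
      M * ℓ * ⌊(X i k + (ε k : ℕ) * (ℓ / 2)) / (M * ℓ)⌋ := fun k => rfl
  have hPj : ∀ k, P j k = X j k + (ε k : ℕ) * (ℓ / 2) -
      M * ℓ * ⌊(X j k + (ε k : ℕ) * (ℓ / 2)) / (M * ℓ)⌋ := fun k => rfl
  have hsame : ∀ k : Fin 3, ⌊P i k / ℓ⌋ = ⌊P j k / ℓ⌋ := fun k => by
    rw [hPi, hPj]; exact (hε k).1
  have hdiff : P i - P j = X i - X j - latticeVec L n₀ := by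
    ext k
    rw [PiLp.sub_apply, hPi, hPj, (hε k).2]
    rfl
  simp only []
  rw [if_pos hsame, dist_eq_norm, hdiff, hper]

/-! ### The torus step -/

/-- The same-cell pair sum `∑_{i<j, same grid cube} W(|xᵢ-xⱼ|)` is measurable (for measurable
`W`). [folklore] -/
theorem measurable_sameCellSum {N : ℕ} {W : ℝ → ℝ≥0∞} (hW : Measurable W) (ℓ : ℝ) :
    Measurable fun X : Config N => ∑ i : Fin N, ∑ j : Fin N with i < j,
      if (∀ k : Fin 3, ⌊X i k / ℓ⌋ = ⌊X j k / ℓ⌋) then W (dist (X i) (X j)) else 0 := by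
  refine Finset.measurable_sum _ fun i _ => Finset.measurable_sum _ fun j _ => ?_
  refine Measurable.ite ?_ (hW.comp ((measurable_pi_apply i).dist (measurable_pi_apply j)))
    measurable_const
  have : {X : Config N | ∀ k : Fin 3, ⌊X i k / ℓ⌋ = ⌊X j k / ℓ⌋} =
      ⋂ k : Fin 3, {X : Config N | ⌊X i k / ℓ⌋ = ⌊X j k / ℓ⌋} := by
    ext X; simp
  rw [this]
  refine MeasurableSet.iInter fun k => measurableSet_eq_fun ?_ ?_
  · exact Int.measurable_floor.comp (by fun_prop)
  · exact Int.measurable_floor.comp (by fun_prop)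

/-- **The torus step of Lee's Theorem 7 (finite average over shifted grids).** Let `L = Mℓ`,
`M ≥ 1`, `W ≥ 0` measurable of range `R₀` with `4R₀ ≤ ℓ`. Suppose that for every periodic
trial state `Φ` of `N` particles on the torus of side `L`, the same-cell `W`-pair form on the
cube `Λ_L^N` is dominated by the Neumann energy with `v`:
`c ∫_{Λ_L^N} (∑_{i<j, same cube} W)|Φ|² ≤ ∫_{Λ_L^N} (|∇Φ|² + (∑_{i<j} v)|Φ|²)` (the cell
method). Then for every periodic trial state `Ψ`,
`c ∫_{[0,L)^{3N}} (∑_{i<j} W^per(xᵢ-xⱼ))|Ψ|² ≤ 8 · periodicEnergy v Ψ`: bound `W^per`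
pointwise by the `8` shifted same-cell sums (`periodicInteraction_le_sum_sameCell`), move each
shift onto the state (`Ψ(· - s_ε)` is a trial state of the same energy), and use that the
Neumann energy with `v` is at most the periodic energy with `v^per`.
[cite: Lee2009, Thm. 7] -/
theorem torus_domination_of_grid {N M : ℕ} (hM : 0 < M) {ℓ L : ℝ} (hℓ : 0 < ℓ) (hLℓ : L = M * ℓ)
    {v W : ℝ → ℝ≥0∞} (hW : Measurable W) {R₀ : ℝ} (hWR : ∀ r, R₀ < r → W r = 0)
    (hRℓ : 4 * R₀ ≤ ℓ) {c : ℝ≥0∞}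
    (hgrid : ∀ Φ : PeriodicTrialState N L,
      c * ∫⁻ X in boxN N L, (∑ i : Fin N, ∑ j : Fin N with i < j,
          if (∀ k : Fin 3, ⌊X i k / ℓ⌋ = ⌊X j k / ℓ⌋) then W (dist (X i) (X j)) else 0) *
            (‖Φ.ψ X‖₊ : ℝ≥0∞) ^ 2 ≤
        ∫⁻ X in boxN N L, kineticDensity Φ.ψ X + interaction v X * (‖Φ.ψ X‖₊ : ℝ≥0∞) ^ 2)
    (Ψ : PeriodicTrialState N L) :
    c * ∫⁻ X in cellN N L, periodicInteraction W L X * (‖Ψ.ψ X‖₊ : ℝ≥0∞) ^ 2 ≤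
      8 * periodicEnergy v Ψ := by
  subst hLℓ
  have hL : 0 < (M : ℝ) * ℓ := by
    have : (0 : ℝ) < M := by exact_mod_cast hM
    positivity
  set G : Config N → ℝ≥0∞ := fun Y => ∑ i : Fin N, ∑ j : Fin N with i < j,
    if (∀ k : Fin 3, ⌊Y i k / ℓ⌋ = ⌊Y j k / ℓ⌋) then W (dist (Y i) (Y j)) else 0 with hG_def
  have hGm : Measurable G := measurable_sameCellSum hW ℓ
  set sh : (Fin 3 → Fin 2) → Config N := fun ε _ => toLp 2 fun k => ((ε k : ℕ) : ℝ) * (ℓ / 2)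
    with hsh_def
  have hn2 : Measurable fun X => (‖Ψ.ψ X‖₊ : ℝ≥0∞) ^ 2 := measurable_normSq Ψ.contDiff.continuous
  -- Step 1: the pointwise covering inequality, integrated
  have step1 : c * ∫⁻ X in cellN N (M * ℓ), periodicInteraction W (M * ℓ) X *
        (‖Ψ.ψ X‖₊ : ℝ≥0∞) ^ 2 ≤
      ∑ ε : Fin 3 → Fin 2, c * ∫⁻ X in cellN N (M * ℓ),
        G (cellProj (M * ℓ) (X + sh ε)) * (‖Ψ.ψ X‖₊ : ℝ≥0∞) ^ 2 := by
    rw [← Finset.mul_sum, ← lintegral_finsetSum Finset.univ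
      (f := fun ε X => G (cellProj (M * ℓ) (X + sh ε)) * (‖Ψ.ψ X‖₊ : ℝ≥0∞) ^ 2)
      fun ε _ => (hGm.comp ((measurable_cellProj _).comp (measurable_id.add_const _))).mul hn2]
    refine mul_le_mul_right (lintegral_mono fun X => ?_) _
    rw [← Finset.sum_mul]
    exact mul_le_mul_left (periodicInteraction_le_sum_sameCell hM hℓ hWR hRℓ X) _
  -- Step 2: each shifted term is bounded by the energy
  have step2 : ∀ ε : Fin 3 → Fin 2, c * ∫⁻ X in cellN N (M * ℓ),
      G (cellProj (M * ℓ) (X + sh ε)) * (‖Ψ.ψ X‖₊ : ℝ≥0∞) ^ 2 ≤ periodicEnergy v Ψ := by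
    intro ε
    obtain ⟨Φ, hΦ⟩ := Ψ.exists_translate (toLp 2 fun k => ((ε k : ℕ) : ℝ) * (ℓ / 2))
    -- move the shift onto the state
    have hper : ∀ (X : Config N) (i : Fin N) (k : Fin 3),
        (fun Y => G (cellProj (M * ℓ) (Y + sh ε)) * (‖Ψ.ψ Y‖₊ : ℝ≥0∞) ^ 2)
          (X + Pi.single i (EuclideanSpace.single k (M * ℓ))) =
        (fun Y => G (cellProj (M * ℓ) (Y + sh ε)) * (‖Ψ.ψ Y‖₊ : ℝ≥0∞) ^ 2) X := by
      intro X i k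
      simp only []
      rw [Ψ.periodic, add_right_comm, cellProj_add_single hL.ne']
    have hshift : ∫⁻ X in cellN N (M * ℓ), G (cellProj (M * ℓ) (X + sh ε)) *
          (‖Ψ.ψ X‖₊ : ℝ≥0∞) ^ 2 =
        ∫⁻ X in cellN N (M * ℓ), G X * (‖Φ.ψ X‖₊ : ℝ≥0∞) ^ 2 := by
      rw [← Ψ.lintegral_cellN_comp_sub hper (sh ε)]
      refine setLIntegral_congr_fun (measurableSet_cellN N _) fun X hX => ?_
      simp only [sub_add_cancel, hΦ]
      rw [cellProj_of_mem_cellN hL hX]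
    rw [hshift, ← setLIntegral_congr (boxN_ae_eq_cellN N (M * ℓ))]
    calc c * ∫⁻ X in boxN N (M * ℓ), G X * (‖Φ.ψ X‖₊ : ℝ≥0∞) ^ 2
        ≤ ∫⁻ X in boxN N (M * ℓ), kineticDensity Φ.ψ X +
            interaction v X * (‖Φ.ψ X‖₊ : ℝ≥0∞) ^ 2 := hgrid Φ
      _ = neumannEnergy v Φ.toNeumann := rfl
      _ ≤ periodicEnergy v Φ := Φ.neumannEnergy_toNeumann_le v
      _ = periodicEnergy v Ψ := periodicEnergy_translate v Ψ _ hΦ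
  -- Step 3: sum over the eight shifts
  calc c * ∫⁻ X in cellN N (M * ℓ), periodicInteraction W (M * ℓ) X * (‖Ψ.ψ X‖₊ : ℝ≥0∞) ^ 2
      ≤ ∑ ε : Fin 3 → Fin 2, c * ∫⁻ X in cellN N (M * ℓ),
          G (cellProj (M * ℓ) (X + sh ε)) * (‖Ψ.ψ X‖₊ : ℝ≥0∞) ^ 2 := step1
    _ ≤ ∑ _ε : Fin 3 → Fin 2, periodicEnergy v Ψ := Finset.sum_le_sum fun ε _ => step2 ε
    _ = 8 * periodicEnergy v Ψ := by
        rw [Finset.sum_const, Finset.card_univ, Fintype.card_fun, Fintype.card_fin,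
          Fintype.card_fin, nsmul_eq_mul]
        norm_num

end Literature.MathematicalPhysics.QuantumManyBody.BoseGas

end
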